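import Mathlib.MeasureTheory.Measure.Haar.InnerProductSpace
import Mathlib.MeasureTheory.Group.Measure
import Literature.Analysis.FluidPDE.QuasiSelfSimilarCompatibleBlocks
import HarnessLib

/-!
# Symmetries of the square acting on building blocks (Alberti–Crippa–Mazzucato 2019, §6.5, §8)

Topic `Literature/Analysis/FluidPDE`. The quasi-self-similar family of Alberti–Crippa–Mazzucato
uses `N = 6` building blocks: "the two rotations of the straight channel and the four rotations of
the bent channel" (ACM 2019, §6.5; Bruè–De Lellis 2023, §4.1), i.e. two generating blocks moved
around by the symmetry group of the square. This file provides that bookkeeping once and for all: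
the dihedral group of `[0,1]²` as explicit affine maps (`SquareSymm`: a permutation of the two
axes and a flip per axis), its action on scalars `Θ(t, z) ↦ Θ(t, τ⁻¹ z)` and on velocity fields
`V(t, z) ↦ L_τ V(t, τ⁻¹ z)`, and the transfer of every analytic clause of
`QuasiSelfSimilar.IsCompatibleBlockSystem` along the action: smoothness, incompressibility,
tangency, transport, the bound `|Θ| ≤ 10`, the integrals `∫_{[0,1)²} Θ` and `∫ Θ²` (the maps are
volume preserving and permute the half-open faces of the cube, a null set), the self-similarity
clause (subsquare indices are moved by the induced symmetry of the `5 × 5` grid) and the geometry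
of faces, strips, windows and face midpoints entering the boundary clauses.

## References

* G. Alberti, G. Crippa, A. L. Mazzucato, *Exponential self-similar mixing by incompressible
  flows*, J. Amer. Math. Soc. 32 (2019), §6.5 ("two rotations of the straight channel and the four
  rotations of the bent channel"), §8.1 (e) ("translated, rescaled, and possibly rotated copy"),
  §8.6 (arXiv:1605.02090).
* E. Bruè, C. De Lellis, *Anomalous dissipation for the forced 3D Navier–Stokes equations*,
  Comm. Math. Phys. 400 (2023), §4.1 (`N = 6`).
-/

noncomputable section

open MeasureTheory Set Filter Function

open scoped ContDiff

namespace Literature.Analysis.FluidPDE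

namespace QuasiSelfSimilar

open FunctionSpaces FunctionSpaces.Torus

/-! ## The symmetry group of the square -/

/-- **A symmetry of the unit square** `[0,1]²` (an element of its dihedral group, `8` elements):
a permutation `perm` of the two axes and a flip `flip k` per axis; it acts by
`(τ • z)_k = 1 - z_{perm k}` if `flip k`, `= z_{perm k}` otherwise (ACM 2019, §8.1 (e):
"translated, rescaled, and possibly rotated copy"; reflections included). [cite: AlbertiCrippaMazzucato2019, §8.1 (e)] -/
structure SquareSymm where
  /-- the permutation of the axes -/
  perm : Equiv.Perm (Fin 2)
  /-- the flips `z ↦ 1 - z` per axis (after permuting) -/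
  flip : Fin 2 → Bool

namespace SquareSymm

variable (τ : SquareSymm)

/-- The sign `±1` of the axis `k`. [folklore] -/
def sgn (k : Fin 2) : ℝ := if τ.flip k then -1 else 1

/-- `sgn k ^ 2 = 1`. [folklore] -/
theorem sgn_mul_self (k : Fin 2) : τ.sgn k * τ.sgn k = 1 := by
  unfold sgn; split_ifs <;> norm_num

/-- `|sgn k| = 1`. [folklore] -/
theorem abs_sgn (k : Fin 2) : |τ.sgn k| = 1 := by
  unfold sgn; split_ifs <;> norm_num

/-- **The action on points**: `(τ • z)_k = 1 - z_{perm k}` if `flip k`, else `z_{perm k}`. [cite: AlbertiCrippaMazzucato2019, §8.1 (e)] -/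
def act (z : EuclideanSpace ℝ (Fin 2)) : EuclideanSpace ℝ (Fin 2) :=
  WithLp.toLp 2 fun k => if τ.flip k then 1 - z (τ.perm k) else z (τ.perm k)

/-- Coordinates of the action. [folklore] -/
theorem act_apply (z : EuclideanSpace ℝ (Fin 2)) (k : Fin 2) :
    τ.act z k = if τ.flip k then 1 - z (τ.perm k) else z (τ.perm k) := rfl

/-- Coordinates of the action in affine form: `(τ • z)_k = sgn k · z_{perm k} + [flip k]`. [folklore] -/
theorem act_apply' (z : EuclideanSpace ℝ (Fin 2)) (k : Fin 2) :
    τ.act z k = τ.sgn k * z (τ.perm k) + (if τ.flip k then 1 else 0) := by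
  rw [act_apply]; unfold sgn; split_ifs <;> ring

/-- **The linear part** `(L_τ v)_k = sgn k · v_{perm k}` as a linear map. [folklore] -/
def linMap : EuclideanSpace ℝ (Fin 2) →ₗ[ℝ] EuclideanSpace ℝ (Fin 2) where
  toFun v := WithLp.toLp 2 fun k => τ.sgn k * v (τ.perm k)
  map_add' v w := by ext k; simp [mul_add]
  map_smul' c v := by ext k; simp; ring

/-- Coordinates of the linear part. [folklore] -/
theorem linMap_apply (v : EuclideanSpace ℝ (Fin 2)) (k : Fin 2) :
    τ.linMap v k = τ.sgn k * v (τ.perm k) := rfl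

/-- The linear part preserves the Euclidean norm. [folklore] -/
theorem norm_linMap (v : EuclideanSpace ℝ (Fin 2)) : ‖τ.linMap v‖ = ‖v‖ := by
  have h : ‖τ.linMap v‖ ^ 2 = ‖v‖ ^ 2 := by
    rw [EuclideanSpace.real_norm_sq_eq, EuclideanSpace.real_norm_sq_eq]
    have : ∀ k, τ.linMap v k ^ 2 = v (τ.perm k) ^ 2 := fun k => by
      rw [linMap_apply, mul_pow]
      have : τ.sgn k ^ 2 = 1 := by rw [sq, sgn_mul_self]
      rw [this, one_mul]
    simp_rw [this]
    exact Equiv.sum_comp τ.perm (fun j => v j ^ 2)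
  nlinarith [norm_nonneg (τ.linMap v), norm_nonneg v, sq_nonneg (‖τ.linMap v‖ - ‖v‖),
    sq_nonneg (‖τ.linMap v‖ + ‖v‖)]

/-- **The inverse symmetry**. [folklore] -/
def inv : SquareSymm := ⟨τ.perm.symm, fun j => τ.flip (τ.perm.symm j)⟩

/-- Coordinates of the inverse action at a permuted index:
`(τ⁻¹ • z)_{perm k} = 1 - z_k` if `flip k`, else `z_k`. [folklore] -/
theorem inv_act_apply_perm (z : EuclideanSpace ℝ (Fin 2)) (k : Fin 2) :
    τ.inv.act z (τ.perm k) = if τ.flip k then 1 - z k else z k := by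
  rw [act_apply]
  simp [inv]

/-- Coordinates of the inverse linear part at a permuted index:
`(L_{τ⁻¹} v)_{perm k} = sgn k · v_k`. [folklore] -/
theorem inv_linMap_apply_perm (v : EuclideanSpace ℝ (Fin 2)) (k : Fin 2) :
    τ.inv.linMap v (τ.perm k) = τ.sgn k * v k := by
  rw [linMap_apply]
  simp [inv, sgn]

/-- `τ⁻¹ ∘ τ = id` on points. [folklore] -/
theorem inv_act_act (z : EuclideanSpace ℝ (Fin 2)) : τ.inv.act (τ.act z) = z := by
  ext j
  obtain ⟨k, rfl⟩ := τ.perm.surjective j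
  rw [inv_act_apply_perm, act_apply]
  split_ifs <;> ring

/-- `τ ∘ τ⁻¹ = id` on points. [folklore] -/
theorem act_inv_act (z : EuclideanSpace ℝ (Fin 2)) : τ.act (τ.inv.act z) = z := by
  ext k
  rw [act_apply, inv_act_apply_perm]
  split_ifs <;> ring

/-- `L_{τ⁻¹} ∘ L_τ = id`. [folklore] -/
theorem inv_linMap_linMap (v : EuclideanSpace ℝ (Fin 2)) : τ.inv.linMap (τ.linMap v) = v := by
  ext j
  obtain ⟨k, rfl⟩ := τ.perm.surjective j
  rw [inv_linMap_apply_perm, linMap_apply, ← mul_assoc, sgn_mul_self, one_mul]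

/-- `L_τ ∘ L_{τ⁻¹} = id`. [folklore] -/
theorem linMap_inv_linMap (v : EuclideanSpace ℝ (Fin 2)) : τ.linMap (τ.inv.linMap v) = v := by
  ext k
  rw [linMap_apply, inv_linMap_apply_perm, ← mul_assoc, sgn_mul_self, one_mul]

/-- The action is affine: `τ • z - τ • z' = L_τ (z - z')`. [folklore] -/
theorem act_sub_act (z z' : EuclideanSpace ℝ (Fin 2)) : τ.act z - τ.act z' = τ.linMap (z - z') := by
  ext k
  rw [PiLp.sub_apply, act_apply', act_apply', linMap_apply, PiLp.sub_apply]
  ring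

/-- The action as "linear part plus constant": `τ • z = L_τ z + τ • 0`. [folklore] -/
theorem act_eq_linMap_add (z : EuclideanSpace ℝ (Fin 2)) : τ.act z = τ.linMap z + τ.act 0 := by
  have h := τ.act_sub_act z 0
  rw [sub_zero] at h
  rw [← h, sub_add_cancel]

/-- **The linear part as a linear isometry equivalence** of `ℝ²`. [folklore] -/
def linIso : EuclideanSpace ℝ (Fin 2) ≃ₗᵢ[ℝ] EuclideanSpace ℝ (Fin 2) where
  toFun := τ.linMap
  invFun := τ.inv.linMap
  map_add' := τ.linMap.map_add
  map_smul' := τ.linMap.map_smul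
  left_inv := τ.inv_linMap_linMap
  right_inv := τ.linMap_inv_linMap
  norm_map' := τ.norm_linMap

/-- Unfolding `linIso`. [folklore] -/
@[simp] theorem linIso_apply (v : EuclideanSpace ℝ (Fin 2)) : τ.linIso v = τ.linMap v := rfl

/-- The linear part as a continuous linear map (`L_τ = D(τ • ·)`). [folklore] -/
def lin : EuclideanSpace ℝ (Fin 2) →L[ℝ] EuclideanSpace ℝ (Fin 2) :=
  τ.linIso.toContinuousLinearEquiv.toContinuousLinearMap

/-- Unfolding `lin`. [folklore] -/
@[simp] theorem lin_apply (v : EuclideanSpace ℝ (Fin 2)) : τ.lin v = τ.linMap v := rfl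

/-- The action is continuous. [folklore] -/
theorem continuous_act : Continuous τ.act := by
  have : τ.act = fun z => τ.linMap z + τ.act 0 := funext τ.act_eq_linMap_add
  rw [this]
  exact (τ.linIso.continuous).add continuous_const

/-- **The action as a homeomorphism** of `ℝ²`. [folklore] -/
def actHomeomorph : EuclideanSpace ℝ (Fin 2) ≃ₜ EuclideanSpace ℝ (Fin 2) where
  toFun := τ.act
  invFun := τ.inv.act
  left_inv := τ.inv_act_act
  right_inv := τ.act_inv_act
  continuous_toFun := τ.continuous_act
  continuous_invFun := τ.inv.continuous_act

/-- The derivative of the action is the linear part. [folklore] -/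
theorem hasFDerivAt_act (z : EuclideanSpace ℝ (Fin 2)) : HasFDerivAt τ.act τ.lin z := by
  have : τ.act = fun z => τ.lin z + τ.act 0 := funext fun z => by
    rw [lin_apply]; exact τ.act_eq_linMap_add z
  rw [this]
  exact τ.lin.hasFDerivAt.add_const _

/-- The action is smooth. [folklore] -/
theorem contDiff_act {n : WithTop ℕ∞} : ContDiff ℝ n τ.act := by
  have : τ.act = fun z => τ.lin z + τ.act 0 := funext fun z => by
    rw [lin_apply]; exact τ.act_eq_linMap_add z
  rw [this]
  exact τ.lin.contDiff.add contDiff_const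

/-- **The action preserves Lebesgue measure** (isometry followed by a translation). [folklore] -/
theorem measurePreserving_act : MeasurePreserving τ.act volume volume := by
  have : τ.act = (fun z => z + τ.act 0) ∘ τ.linIso := funext fun z => by
    simp only [comp_apply, linIso_apply]; exact τ.act_eq_linMap_add z
  rw [this]
  exact (measurePreserving_add_right volume (τ.act 0)).comp τ.linIso.measurePreserving

/-- The action maps the closed square onto itself. [folklore] -/
theorem act_mem_closedSquare {z : EuclideanSpace ℝ (Fin 2)} (hz : z ∈ closedSquare) :
    τ.act z ∈ closedSquare := by
  intro k
  rw [act_apply]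
  obtain ⟨h0, h1⟩ := hz (τ.perm k)
  split_ifs
  · exact ⟨by linarith, by linarith⟩
  · exact ⟨h0, h1⟩

/-- A point lies in the closed square iff its image does. [folklore] -/
theorem act_mem_closedSquare_iff {z : EuclideanSpace ℝ (Fin 2)} :
    τ.act z ∈ closedSquare ↔ z ∈ closedSquare := by
  refine ⟨fun h => ?_, τ.act_mem_closedSquare⟩
  have := τ.inv.act_mem_closedSquare h
  rwa [inv_act_act] at this

/-! ## The action on blocks -/

/-- **The action on scalar blocks**: `(τ • Θ)(t, z) = Θ(t, τ⁻¹ z)` (ACM 2019, §8.1 (e); §6.5: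
rotated copies of the channels). [cite: AlbertiCrippaMazzucato2019, §6.5] -/
def actScalar (Θ : ℝ → EuclideanSpace ℝ (Fin 2) → ℝ) : ℝ → EuclideanSpace ℝ (Fin 2) → ℝ :=
  fun t z => Θ t (τ.inv.act z)

/-- **The action on velocity blocks**: `(τ • V)(t, z) = L_τ V(t, τ⁻¹ z)` (push-forward of the
vector field). [cite: AlbertiCrippaMazzucato2019, §6.5] -/
def actVelocity (V : ℝ → EuclideanSpace ℝ (Fin 2) → EuclideanSpace ℝ (Fin 2)) :
    ℝ → EuclideanSpace ℝ (Fin 2) → EuclideanSpace ℝ (Fin 2) :=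
  fun t z => τ.linMap (V t (τ.inv.act z))

variable {τ}

/-- Unfolding `actScalar`. [folklore] -/
theorem actScalar_apply (Θ : ℝ → EuclideanSpace ℝ (Fin 2) → ℝ) (t : ℝ)
    (z : EuclideanSpace ℝ (Fin 2)) : τ.actScalar Θ t z = Θ t (τ.inv.act z) := rfl

/-- Unfolding `actVelocity`. [folklore] -/
theorem actVelocity_apply (V : ℝ → EuclideanSpace ℝ (Fin 2) → EuclideanSpace ℝ (Fin 2)) (t : ℝ)
    (z : EuclideanSpace ℝ (Fin 2)) : τ.actVelocity V t z = τ.linMap (V t (τ.inv.act z)) := rfl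

variable (τ)

/-- Smoothness transfers to the moved scalar. [folklore] -/
theorem contDiff_actScalar {Θ : ℝ → EuclideanSpace ℝ (Fin 2) → ℝ} {n : WithTop ℕ∞}
    (h : ContDiff ℝ n (uncurry Θ)) : ContDiff ℝ n (uncurry (τ.actScalar Θ)) :=
  h.comp (contDiff_fst.prodMk (τ.inv.contDiff_act.comp contDiff_snd))

/-- Smoothness transfers to the moved velocity. [folklore] -/
theorem contDiff_actVelocity {V : ℝ → EuclideanSpace ℝ (Fin 2) → EuclideanSpace ℝ (Fin 2)}
    {n : WithTop ℕ∞} (h : ContDiff ℝ n (uncurry V)) : ContDiff ℝ n (uncurry (τ.actVelocity V)) :=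
  τ.lin.contDiff.comp (h.comp (contDiff_fst.prodMk (τ.inv.contDiff_act.comp contDiff_snd)))

/-- Derivative of a moved scalar slice: `D(Θ_t ∘ τ⁻¹)(z) = DΘ_t(τ⁻¹ z) ∘ L_{τ⁻¹}`. [folklore] -/
theorem fderiv_actScalar {Θ : ℝ → EuclideanSpace ℝ (Fin 2) → ℝ} {t : ℝ} {z : EuclideanSpace ℝ (Fin 2)}
    (h : DifferentiableAt ℝ (Θ t) (τ.inv.act z)) :
    fderiv ℝ (τ.actScalar Θ t) z = (fderiv ℝ (Θ t) (τ.inv.act z)).comp τ.inv.lin := by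
  have : τ.actScalar Θ t = Θ t ∘ τ.inv.act := rfl
  rw [this, fderiv_comp z h (τ.inv.hasFDerivAt_act z).differentiableAt,
    (τ.inv.hasFDerivAt_act z).fderiv]

/-- Derivative of a moved velocity slice:
`D(L_τ V_t ∘ τ⁻¹)(z) = L_τ ∘ DV_t(τ⁻¹ z) ∘ L_{τ⁻¹}`. [folklore] -/
theorem fderiv_actVelocity {V : ℝ → EuclideanSpace ℝ (Fin 2) → EuclideanSpace ℝ (Fin 2)} {t : ℝ}
    {z : EuclideanSpace ℝ (Fin 2)} (h : DifferentiableAt ℝ (V t) (τ.inv.act z)) :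
    fderiv ℝ (τ.actVelocity V t) z = (τ.lin.comp (fderiv ℝ (V t) (τ.inv.act z))).comp τ.inv.lin := by
  have h1 : τ.actVelocity V t = τ.lin ∘ (V t ∘ τ.inv.act) := by
    funext z; simp [actVelocity_apply]
  have h2 : DifferentiableAt ℝ (V t ∘ τ.inv.act) z :=
    h.comp z (τ.inv.hasFDerivAt_act z).differentiableAt
  rw [h1, fderiv_comp z τ.lin.differentiableAt h2, τ.lin.fderiv,
    fderiv_comp z h (τ.inv.hasFDerivAt_act z).differentiableAt, (τ.inv.hasFDerivAt_act z).fderiv]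
  rfl

/-- The inverse linear part on basis vectors: `L_{τ⁻¹} e_k = sgn k · e_{perm k}`. [folklore] -/
theorem inv_linMap_single (k : Fin 2) :
    τ.inv.linMap (EuclideanSpace.single k (1 : ℝ)) = τ.sgn k • EuclideanSpace.single (τ.perm k) 1 := by
  ext j
  obtain ⟨i, rfl⟩ := τ.perm.surjective j
  rw [inv_linMap_apply_perm, PiLp.smul_apply, smul_eq_mul]
  by_cases hik : i = k
  · subst hik; simp
  · have : τ.perm i ≠ τ.perm k := fun h => hik (τ.perm.injective h)
    simp [hik, this]

/-- **Transport transfers**: `∂ₜ(τ•Θ) + D(τ•Θ)[τ•V]` at `(t, z)` equals `∂ₜΘ + DΘ[V]` at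
`(t, τ⁻¹ z)`. [folklore] -/
theorem transport_act {V : ℝ → EuclideanSpace ℝ (Fin 2) → EuclideanSpace ℝ (Fin 2)}
    {Θ : ℝ → EuclideanSpace ℝ (Fin 2) → ℝ} {t : ℝ} {z : EuclideanSpace ℝ (Fin 2)}
    (h : DifferentiableAt ℝ (Θ t) (τ.inv.act z)) :
    deriv (fun s => τ.actScalar Θ s z) t + fderiv ℝ (τ.actScalar Θ t) z (τ.actVelocity V t z) =
      deriv (fun s => Θ s (τ.inv.act z)) t + fderiv ℝ (Θ t) (τ.inv.act z) (V t (τ.inv.act z)) := by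
  rw [τ.fderiv_actScalar h, ContinuousLinearMap.comp_apply, actVelocity_apply, lin_apply,
    inv_linMap_linMap]
  rfl

/-- **Incompressibility transfers**: `div(τ•V)(z) = div V(τ⁻¹ z)`. [folklore] -/
theorem divergence_act {V : ℝ → EuclideanSpace ℝ (Fin 2) → EuclideanSpace ℝ (Fin 2)} {t : ℝ}
    {z : EuclideanSpace ℝ (Fin 2)} (h : DifferentiableAt ℝ (V t) (τ.inv.act z)) :
    ∑ j, fderiv ℝ (τ.actVelocity V t) z (EuclideanSpace.single j 1) j =
      ∑ j, fderiv ℝ (V t) (τ.inv.act z) (EuclideanSpace.single j 1) j := by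
  rw [τ.fderiv_actVelocity h]
  have hterm : ∀ j, ((τ.lin.comp (fderiv ℝ (V t) (τ.inv.act z))).comp τ.inv.lin)
      (EuclideanSpace.single j 1) j =
      fderiv ℝ (V t) (τ.inv.act z) (EuclideanSpace.single (τ.perm j) 1) (τ.perm j) := by
    intro j
    rw [ContinuousLinearMap.comp_apply, ContinuousLinearMap.comp_apply, lin_apply, lin_apply,
      inv_linMap_single, map_smul, map_smul, PiLp.smul_apply, linMap_apply, smul_eq_mul, ← mul_assoc,
      sgn_mul_self, one_mul]
  simp_rw [hterm]
  exact Equiv.sum_comp τ.perm (fun i => fderiv ℝ (V t) (τ.inv.act z) (EuclideanSpace.single i 1) i)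

/-- **Tangency transfers**: if the normal component of `V(t)` vanishes on the faces of the closed
square, so does that of `τ • V(t)`. [folklore] -/
theorem tangent_act {V : ℝ → EuclideanSpace ℝ (Fin 2) → EuclideanSpace ℝ (Fin 2)} {t : ℝ}
    (h : ∀ z ∈ closedSquare, ∀ j, (z j = 0 ∨ z j = 1) → V t z j = 0)
    {z : EuclideanSpace ℝ (Fin 2)} (hz : z ∈ closedSquare) (j : Fin 2) (hj : z j = 0 ∨ z j = 1) :
    τ.actVelocity V t z j = 0 := by
  rw [actVelocity_apply, linMap_apply]
  have hw : τ.inv.act z ∈ closedSquare := τ.inv.act_mem_closedSquare hz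
  have hwj : τ.inv.act z (τ.perm j) = 0 ∨ τ.inv.act z (τ.perm j) = 1 := by
    rw [inv_act_apply_perm]
    rcases hj with h0 | h1
    · rw [h0]; split_ifs <;> norm_num
    · rw [h1]; split_ifs <;> norm_num
  rw [h _ hw _ hwj, mul_zero]

/-! ## Integrals over the fundamental square -/

/-- Coordinate hyperplanes are Lebesgue null in `ℝ²`. [folklore] -/
theorem volume_setOf_apply_eq (k : Fin 2) (c : ℝ) :
    volume {z : EuclideanSpace ℝ (Fin 2) | z k = c} = 0 := by
  -- the hyperplane `{z_k = 0}` is a proper submodule, `{z_k = c}` its translate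
  let S : Submodule ℝ (EuclideanSpace ℝ (Fin 2)) :=
    LinearMap.ker (EuclideanSpace.projₗ k : EuclideanSpace ℝ (Fin 2) →ₗ[ℝ] ℝ)
  have hS : (S : Set (EuclideanSpace ℝ (Fin 2))) = {z | z k = 0} := by
    ext z
    simp only [S, SetLike.mem_coe, LinearMap.mem_ker, mem_setOf_eq]
    rfl
  have hne : S ≠ ⊤ := by
    intro htop
    have hmem : EuclideanSpace.single k (1 : ℝ) ∈ S := by rw [htop]; trivial
    have : (EuclideanSpace.single k (1 : ℝ) : EuclideanSpace ℝ (Fin 2)) k = 0 := by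
      have h' : EuclideanSpace.single k (1 : ℝ) ∈ (S : Set (EuclideanSpace ℝ (Fin 2))) := hmem
      rw [hS] at h'
      exact h'
    simp at this
  have h0 : volume {z : EuclideanSpace ℝ (Fin 2) | z k = 0} = 0 := by
    rw [← hS]; exact Measure.addHaar_submodule volume S hne
  have htrans : {z : EuclideanSpace ℝ (Fin 2) | z k = c} =
      (fun z => z + (-(EuclideanSpace.single k c))) ⁻¹' {z | z k = 0} := by
    ext z
    simp only [mem_setOf_eq, mem_preimage, PiLp.add_apply, PiLp.neg_apply, PiLp.single_apply,
      if_true]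
    constructor <;> intro h <;> linarith
  rw [htrans, measure_preimage_add_right]
  exact h0

/-- The boundary of the cube inside the closed square is null: the set of points of the closed
square not in the open square has measure zero. [folklore] -/
theorem volume_closedSquare_diff_openSquare : volume (closedSquare \ openSquare) = 0 := by
  have hsub : closedSquare \ openSquare ⊆
      ⋃ k : Fin 2, ({z : EuclideanSpace ℝ (Fin 2) | z k = 0} ∪ {z | z k = 1}) := by
    intro z hz
    obtain ⟨hc, ho⟩ := hz
    simp only [openSquare, mem_setOf_eq, not_forall] at ho
    obtain ⟨k, hk⟩ := ho
    refine mem_iUnion.2 ⟨k, ?_⟩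
    obtain ⟨h0, h1⟩ := hc k
    rcases h0.eq_or_lt with h | h
    · exact Or.inl h.symm
    · rcases h1.eq_or_lt with h' | h'
      · exact Or.inr h'
      · exact absurd ⟨h, h'⟩ hk
  refine measure_mono_null hsub ?_
  refine (measure_iUnion_null_iff).2 fun k => ?_
  exact measure_union_null (volume_setOf_apply_eq k 0) (volume_setOf_apply_eq k 1)

/-- A set squeezed between the open and the closed square is a.e. equal to the fundamental cube
`[0,1)²`. [folklore] -/
theorem ae_eq_unitCube_of_subset {A : Set (EuclideanSpace ℝ (Fin 2))} (h1 : openSquare ⊆ A)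
    (h2 : A ⊆ closedSquare) : A =ᵐ[volume] unitCube (Fin 2) := by
  have hU1 : openSquare ⊆ unitCube (Fin 2) := fun z hz k => Ioo_subset_Ico_self (hz k)
  have hU2 : unitCube (Fin 2) ⊆ closedSquare := fun z hz k => Ico_subset_Icc_self (hz k)
  have hnull := volume_closedSquare_diff_openSquare
  rw [MeasureTheory.ae_eq_set]
  refine ⟨?_, ?_⟩
  · have hsub : A \ unitCube (Fin 2) ⊆ closedSquare \ openSquare :=
      fun z hz => ⟨h2 hz.1, fun ho => hz.2 (hU1 ho)⟩
    exact measure_mono_null hsub hnull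
  · have hsub : unitCube (Fin 2) \ A ⊆ closedSquare \ openSquare :=
      fun z hz => ⟨hU2 hz.1, fun ho => hz.2 (h1 ho)⟩
    exact measure_mono_null hsub hnull

/-- **Integrals over the fundamental cube are invariant under the symmetries of the square**:
`∫_{[0,1)²} F(τ⁻¹ z) dz = ∫_{[0,1)²} F`. [folklore] -/
theorem setIntegral_unitCube_comp_inv_act (F : EuclideanSpace ℝ (Fin 2) → ℝ) :
    ∫ z in unitCube (Fin 2), F (τ.inv.act z) = ∫ z in unitCube (Fin 2), F z := by
  have hmp := τ.inv.measurePreserving_act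
  have hemb : MeasurableEmbedding τ.inv.act := τ.inv.actHomeomorph.measurableEmbedding
  -- `unitCube = (τ⁻¹)⁻¹' (τ⁻¹ '' unitCube)` and `τ⁻¹ '' unitCube = τ⁻¹' unitCube`
  have hpre : τ.inv.act ⁻¹' (τ.act ⁻¹' unitCube (Fin 2)) = unitCube (Fin 2) := by
    ext z; simp [act_inv_act]
  have key := hmp.setIntegral_preimage_emb hemb F (τ.act ⁻¹' unitCube (Fin 2))
  rw [hpre] at key
  rw [key]
  refine setIntegral_congr_set (ae_eq_unitCube_of_subset ?_ ?_)
  · intro z hz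
    show τ.act z ∈ unitCube (Fin 2)
    intro k
    rw [act_apply]
    obtain ⟨h0, h1⟩ := hz (τ.perm k)
    split_ifs
    · exact ⟨by linarith, by linarith⟩
    · exact ⟨h0.le, h1⟩
  · intro z hz
    have hz' : τ.act z ∈ closedSquare := fun k => Ico_subset_Icc_self (hz k)
    exact τ.act_mem_closedSquare_iff.1 hz'

/-- Zero average transfers: `∫_{[0,1)²} (τ•Θ)(t) = ∫_{[0,1)²} Θ(t)`. [folklore] -/
theorem setIntegral_actScalar (Θ : ℝ → EuclideanSpace ℝ (Fin 2) → ℝ) (t : ℝ) :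
    ∫ z in unitCube (Fin 2), τ.actScalar Θ t z = ∫ z in unitCube (Fin 2), Θ t z :=
  τ.setIntegral_unitCube_comp_inv_act (Θ t)

/-- Unit mass transfers: `∫_{[0,1)²} (τ•Θ)(t)² = ∫_{[0,1)²} Θ(t)²`. [folklore] -/
theorem setIntegral_actScalar_sq (Θ : ℝ → EuclideanSpace ℝ (Fin 2) → ℝ) (t : ℝ) :
    ∫ z in unitCube (Fin 2), τ.actScalar Θ t z ^ 2 = ∫ z in unitCube (Fin 2), Θ t z ^ 2 :=
  τ.setIntegral_unitCube_comp_inv_act fun z => Θ t z ^ 2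

/-! ## Subsquares -/

/-- **The induced symmetry of the `5 × 5` grid of subsquares**: the subsquare `p` is mapped by
`τ⁻¹` onto the subsquare `subIdx τ p`, `(subIdx τ p)_{perm k} = 4 - p_k` if `flip k`, else `p_k`
(written with the inverse data: index `j` carries `p_{perm⁻¹ j}`, reversed iff `flip (perm⁻¹ j)`). [folklore] -/
def subIdx (p : Fin 2 → Fin 5) : Fin 2 → Fin 5 :=
  fun j => if τ.flip (τ.perm.symm j) then (p (τ.perm.symm j)).rev else p (τ.perm.symm j)

/-- The induced grid symmetry at a permuted index. [folklore] -/
theorem subIdx_apply_perm (p : Fin 2 → Fin 5) (k : Fin 2) :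
    τ.subIdx p (τ.perm k) = if τ.flip k then (p k).rev else p k := by
  simp [subIdx]

/-- `τ⁻¹` maps the open subsquare `p` into the open subsquare `subIdx τ p`. [folklore] -/
theorem inv_act_mem_latticeCellInterior {p : Fin 2 → Fin 5} {z : EuclideanSpace ℝ (Fin 2)}
    (hz : z ∈ latticeCellInterior 5 (fun k => ((p k : ℕ) : ℤ))) :
    τ.inv.act z ∈ latticeCellInterior 5 (fun k => ((τ.subIdx p k : ℕ) : ℤ)) := by
  intro j
  obtain ⟨k, rfl⟩ := τ.perm.surjective j
  obtain ⟨ha, hb⟩ := hz k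
  simp only [Int.cast_natCast, Nat.cast_ofNat, mem_Ioo] at ha hb ⊢
  rw [inv_act_apply_perm, subIdx_apply_perm]
  split_ifs with hf
  · rw [Fin.val_rev]
    have hk : ((5 - ((p k : ℕ) + 1) : ℕ) : ℝ) = 4 - (p k : ℕ) := by
      have := (p k).isLt
      rw [Nat.cast_sub (by omega)]
      push_cast; ring
    rw [hk]
    constructor
    · rw [div_lt_iff₀ (by norm_num : (0 : ℝ) < 5)]
      rw [lt_div_iff₀ (by norm_num : (0 : ℝ) < 5)] at hb
      linarith
    · rw [lt_div_iff₀ (by norm_num : (0 : ℝ) < 5)]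
      rw [div_lt_iff₀ (by norm_num : (0 : ℝ) < 5)] at ha
      linarith
  · exact ⟨ha, hb⟩

/-- The rescaling to a subsquare commutes with the inverse action:
`5 (τ⁻¹ z) - subIdx τ p = τ⁻¹ (5 z - p)`. [folklore] -/
theorem inv_act_smul_sub (p : Fin 2 → Fin 5) (z : EuclideanSpace ℝ (Fin 2)) :
    (5 : ℝ) • τ.inv.act z - latticeVec (fun k => ((τ.subIdx p k : ℕ) : ℤ)) =
      τ.inv.act ((5 : ℝ) • z - latticeVec (fun k => ((p k : ℕ) : ℤ))) := by
  ext j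
  obtain ⟨k, rfl⟩ := τ.perm.surjective j
  rw [PiLp.sub_apply, PiLp.smul_apply, latticeVec_apply, inv_act_apply_perm, inv_act_apply_perm,
    subIdx_apply_perm, PiLp.sub_apply, PiLp.smul_apply, latticeVec_apply]
  simp only [smul_eq_mul, Int.cast_natCast]
  split_ifs with hf
  · rw [Fin.val_rev]
    have := (p k).isLt
    rw [Nat.cast_sub (by omega)]
    push_cast; ring
  · rfl

/-- **Self-similarity transfers**: if on the open subsquare `p' = subIdx τ p` the block `Θ` at time
`1` is the block `τ' • Θ'` at time `0` rescaled, then on the open subsquare `p` the block `τ • Θ`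
at time `1` is the block `(τ τ') • Θ'` at time `0` rescaled — here stated with the composite
written out: `(τ•Θ)(1, z) = Θ'(0, τ'⁻¹ (τ⁻¹ (5z - p)))`. [folklore] -/
theorem actScalar_selfSimilar {Θ Θ' : ℝ → EuclideanSpace ℝ (Fin 2) → ℝ} {τ' : SquareSymm}
    {p : Fin 2 → Fin 5}
    (h : ∀ w ∈ latticeCellInterior 5 (fun k => ((τ.subIdx p k : ℕ) : ℤ)),
      Θ 1 w = Θ' 0 (τ'.inv.act ((5 : ℝ) • w - latticeVec (fun k => ((τ.subIdx p k : ℕ) : ℤ)))))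
    {z : EuclideanSpace ℝ (Fin 2)} (hz : z ∈ latticeCellInterior 5 (fun k => ((p k : ℕ) : ℤ))) :
    τ.actScalar Θ 1 z = Θ' 0 (τ'.inv.act (τ.inv.act ((5 : ℝ) • z - latticeVec (fun k => ((p k : ℕ) : ℤ))))) := by
  rw [actScalar_apply, h _ (τ.inv_act_mem_latticeCellInterior hz), inv_act_smul_sub]

/-! ## Faces, strips, windows and midpoints -/

/-- The face seen from the base block: the face `(k, s)` of `τ • X` is the face
`(perm k, s xor flip k)` of `X`. [folklore] -/
theorem abs_inv_act_sub_faceValue (z : EuclideanSpace ℝ (Fin 2)) (k : Fin 2) (s : Bool) :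
    |τ.inv.act z (τ.perm k) - faceValue (xor s (τ.flip k))| = |z k - faceValue s| := by
  rw [inv_act_apply_perm]
  cases s <;> cases hf : τ.flip k
  · simp
  · simp only [if_true, Bool.false_bne, faceValue_true, faceValue_false, sub_zero]
    rw [show (1 : ℝ) - z k - 1 = -(z k) by ring, abs_neg]
  · simp
  · simp only [if_true, Bool.true_bne, Bool.not_true, faceValue_true, faceValue_false, sub_zero]
    rw [abs_sub_comm]

/-- Distance to the middle of a side is preserved: `|(τ⁻¹ z)_{perm j} - 1/2| = |z_j - 1/2|`. [folklore] -/
theorem abs_inv_act_sub_half (z : EuclideanSpace ℝ (Fin 2)) (j : Fin 2) :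
    |τ.inv.act z (τ.perm j) - 2⁻¹| = |z j - 2⁻¹| := by
  rw [inv_act_apply_perm]
  split_ifs
  · rw [show (1 : ℝ) - z j - 2⁻¹ = -(z j - 2⁻¹) by ring, abs_neg]
  · rfl

/-- `τ⁻¹` maps face midpoints to face midpoints:
`τ⁻¹ (mid(k, s)) = mid(perm k, s xor flip k)`. [folklore] -/
theorem inv_act_faceMidpoint (k : Fin 2) (s : Bool) :
    τ.inv.act (faceMidpoint k s) = faceMidpoint (τ.perm k) (xor s (τ.flip k)) := by
  ext j
  obtain ⟨i, rfl⟩ := τ.perm.surjective j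
  rw [inv_act_apply_perm, faceMidpoint_apply, faceMidpoint_apply]
  have hinj : (τ.perm i = τ.perm k) ↔ (i = k) := τ.perm.injective.eq_iff
  by_cases hik : i = k
  · subst hik
    simp only [if_true]
    cases s <;> cases hf : τ.flip i <;> simp [faceValue]
  · have : τ.perm i ≠ τ.perm k := fun h => hik (τ.perm.injective h)
    simp only [hik, this, if_false]
    split_ifs <;> norm_num

/-- The offset from a face midpoint, seen from the base block:
`τ⁻¹ z - mid(perm k, s xor flip k) = L_{τ⁻¹} (z - mid(k, s))`. [folklore] -/
theorem inv_act_sub_faceMidpoint (z : EuclideanSpace ℝ (Fin 2)) (k : Fin 2) (s : Bool) :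
    τ.inv.act z - faceMidpoint (τ.perm k) (xor s (τ.flip k)) = τ.inv.linMap (z - faceMidpoint k s) := by
  rw [← inv_act_faceMidpoint, act_sub_act]


/-! ## Composition -/

/-- **Composition of symmetries**: `(τ.mul τ') • z = τ • (τ' • z)`. [folklore] -/
def mul (τ τ' : SquareSymm) : SquareSymm :=
  ⟨τ.perm.trans τ'.perm, fun k => xor (τ.flip k) (τ'.flip (τ.perm k))⟩

/-- The composite acts as the composition. [folklore] -/
theorem mul_act (τ' : SquareSymm) (z : EuclideanSpace ℝ (Fin 2)) :
    (τ.mul τ').act z = τ.act (τ'.act z) := by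
  ext k
  rw [act_apply, act_apply, act_apply]
  simp only [mul, Equiv.trans_apply]
  cases τ.flip k <;> cases τ'.flip (τ.perm k) <;> simp

/-- The action is injective. [folklore] -/
theorem act_injective : Injective τ.act := fun z z' h => by
  have := congrArg τ.inv.act h
  rwa [inv_act_act, inv_act_act] at this

/-- The inverse of a composite acts as the composition of the inverses in reverse order. [folklore] -/
theorem mul_inv_act (τ' : SquareSymm) (z : EuclideanSpace ℝ (Fin 2)) :
    (τ.mul τ').inv.act z = τ'.inv.act (τ.inv.act z) := by
  apply (τ.mul τ').act_injective
  rw [act_inv_act, mul_act, τ'.act_inv_act, τ.act_inv_act]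

/-- Moving a scalar block by a composite is moving it twice. [folklore] -/
theorem actScalar_mul (τ' : SquareSymm) (Θ : ℝ → EuclideanSpace ℝ (Fin 2) → ℝ) :
    (τ.mul τ').actScalar Θ = τ.actScalar (τ'.actScalar Θ) := by
  funext t z
  simp only [actScalar_apply, mul_inv_act]

/-- **Self-similarity transfers, composite form**: under the hypothesis of
`actScalar_selfSimilar`, `(τ•Θ)(1, z) = ((τ.mul τ') • Θ')(0, 5z - p)` on the open subsquare
`p`. [folklore] -/
theorem actScalar_selfSimilar_mul {Θ Θ' : ℝ → EuclideanSpace ℝ (Fin 2) → ℝ} {τ' : SquareSymm}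
    {p : Fin 2 → Fin 5}
    (h : ∀ w ∈ latticeCellInterior 5 (fun k => ((τ.subIdx p k : ℕ) : ℤ)),
      Θ 1 w = τ'.actScalar Θ' 0 ((5 : ℝ) • w - latticeVec (fun k => ((τ.subIdx p k : ℕ) : ℤ))))
    {z : EuclideanSpace ℝ (Fin 2)} (hz : z ∈ latticeCellInterior 5 (fun k => ((p k : ℕ) : ℤ))) :
    τ.actScalar Θ 1 z =
      (τ.mul τ').actScalar Θ' 0 ((5 : ℝ) • z - latticeVec (fun k => ((p k : ℕ) : ℤ))) := by
  rw [actScalar_apply, h _ (τ.inv_act_mem_latticeCellInterior hz), inv_act_smul_sub, actScalar_apply,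
    actScalar_apply, mul_inv_act]

/-! ## Transfer of the boundary clauses -/

/-- **The vanishing clause transfers**: if the base block vanishes on the boundary strips away
from its gate windows (gates `gate`), the moved block does so with the moved gates
`(k, s) ↦ gate (perm k) (s xor flip k)`. [folklore] -/
theorem vanish_act {V : ℝ → EuclideanSpace ℝ (Fin 2) → EuclideanSpace ℝ (Fin 2)}
    {Θ : ℝ → EuclideanSpace ℝ (Fin 2) → ℝ} {gate : Fin 2 → Bool → Prop} {δ : ℝ}
    (h : ∀ (t : ℝ) (z : EuclideanSpace ℝ (Fin 2)) (k : Fin 2) (s : Bool),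
      |z k - faceValue s| < δ → (¬ gate k s ∨ ∃ j, j ≠ k ∧ δ ≤ |z j - 2⁻¹|) → V t z = 0 ∧ Θ t z = 0)
    (t : ℝ) (z : EuclideanSpace ℝ (Fin 2)) (k : Fin 2) (s : Bool) (hz : |z k - faceValue s| < δ)
    (hg : ¬ gate (τ.perm k) (xor s (τ.flip k)) ∨ ∃ j, j ≠ k ∧ δ ≤ |z j - 2⁻¹|) :
    τ.actVelocity V t z = 0 ∧ τ.actScalar Θ t z = 0 := by
  have hz' : |τ.inv.act z (τ.perm k) - faceValue (xor s (τ.flip k))| < δ := by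
    rw [abs_inv_act_sub_faceValue]; exact hz
  have hg' : ¬ gate (τ.perm k) (xor s (τ.flip k)) ∨
      ∃ j, j ≠ τ.perm k ∧ δ ≤ |τ.inv.act z j - 2⁻¹| := by
    rcases hg with hg | ⟨j, hjk, hj⟩
    · exact Or.inl hg
    · refine Or.inr ⟨τ.perm j, fun h' => hjk (τ.perm.injective h'), ?_⟩
      rw [abs_inv_act_sub_half]; exact hj
  obtain ⟨hV, hΘ⟩ := h t (τ.inv.act z) (τ.perm k) (xor s (τ.flip k)) hz' hg'
  refine ⟨?_, hΘ⟩
  rw [actVelocity_apply, hV, map_zero]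

/-- **The gate clause transfers**: if the base block agrees with the gate fields `(Vg k, Θg k)`
inside its gate windows, the moved block agrees, inside the windows of the moved gates, with the
moved gate fields `ζ ↦ L_τ Vg_{perm k}(L_{τ⁻¹} ζ)`, `ζ ↦ Θg_{perm k}(L_{τ⁻¹} ζ)` (for gate fields
equivariant under the symmetries of the square these are the same fields). [folklore] -/
theorem eq_gate_act {V : ℝ → EuclideanSpace ℝ (Fin 2) → EuclideanSpace ℝ (Fin 2)}
    {Θ : ℝ → EuclideanSpace ℝ (Fin 2) → ℝ} {gate : Fin 2 → Bool → Prop}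
    {Vg : Fin 2 → ℝ → EuclideanSpace ℝ (Fin 2) → EuclideanSpace ℝ (Fin 2)}
    {Θg : Fin 2 → ℝ → EuclideanSpace ℝ (Fin 2) → ℝ} {δ : ℝ}
    (h : ∀ (t : ℝ) (z : EuclideanSpace ℝ (Fin 2)) (k : Fin 2) (s : Bool), gate k s →
      |z k - faceValue s| < δ → (∀ j, j ≠ k → |z j - 2⁻¹| < 2 * δ) →
        V t z = Vg k t (z - faceMidpoint k s) ∧ Θ t z = Θg k t (z - faceMidpoint k s))
    (t : ℝ) (z : EuclideanSpace ℝ (Fin 2)) (k : Fin 2) (s : Bool)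
    (hg : gate (τ.perm k) (xor s (τ.flip k))) (hz : |z k - faceValue s| < δ)
    (hw : ∀ j, j ≠ k → |z j - 2⁻¹| < 2 * δ) :
    τ.actVelocity V t z = τ.linMap (Vg (τ.perm k) t (τ.inv.linMap (z - faceMidpoint k s))) ∧
      τ.actScalar Θ t z = Θg (τ.perm k) t (τ.inv.linMap (z - faceMidpoint k s)) := by
  have hz' : |τ.inv.act z (τ.perm k) - faceValue (xor s (τ.flip k))| < δ := by
    rw [abs_inv_act_sub_faceValue]; exact hz
  have hw' : ∀ j, j ≠ τ.perm k → |τ.inv.act z j - 2⁻¹| < 2 * δ := by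
    intro j hj
    obtain ⟨i, rfl⟩ := τ.perm.surjective j
    have hik : i ≠ k := fun h' => hj (by rw [h'])
    rw [abs_inv_act_sub_half]; exact hw i hik
  obtain ⟨hV, hΘ⟩ := h t (τ.inv.act z) (τ.perm k) (xor s (τ.flip k)) hg hz' hw'
  rw [inv_act_sub_faceMidpoint] at hV hΘ
  exact ⟨by rw [actVelocity_apply, hV], by rw [actScalar_apply, hΘ]⟩

end SquareSymm

end QuasiSelfSimilar

end Literature.Analysis.FluidPDE

end
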